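/- Fleet lead `ym-wcr-19456-p1`, route `WeakCouplingRates`, crux `ColdBoxTwoPointFloorW` (stmt-QuantumFields-19608). -/
import Summits.QuantumFields.YangMills.Theorems.WeakCouplingRatesColdBoxDirichletDensity

/-!
# Crux `ColdBoxTwoPointFloorW`, assembly step (b): the Dirichlet form IS the linearised cold-box action

`formM_dir_eq_sum_touching`: for every free-edge datum `s : DirFree H → ℝ`, Chatterjee's pinned lattice Maxwell form of the
enlarged box `dirCorner + {0,…,2H+2}⁴` (the exponent of D1' = `boxDirichlet H`, see `gaussWeight_dirQmat`) equals
`Σ_{p ∈ plaquettesTouching Λ} s(p)²`, `Λ = boxEdges 4 (2H+1)` — i.e. it is indexed by exactly the plaquette set of the Wilson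
boundary action of the cold-wall box state `boxState ρ β H` (`ymSpecification … Λ 1`).  Two inclusions: every plaquette touching
`Λ` lies in the enlarged box (`unshift_mem_plaquettesIn`), and every other plaquette of the enlarged box has circulation
`0` (`sCirc_dirGlue_eq_zero_of_not_touching`, all four edges pinned).  Pure finite-set bookkeeping; no analysis.
-/

set_option autoImplicit false

noncomputable section

open Finset
open Literature.Probability.LatticeModels (Site halfOpenBox mem_halfOpenBox)
open Literature.MathematicalPhysics.QuantumLattice
open Literature.MathematicalPhysics.QuantumFieldTheory
open Literature.MathematicalPhysics.QuantumFieldTheory.LatticeMaxwell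
open Literature.MathematicalPhysics.QuantumFieldTheory.AxialGauge

namespace Summit.QuantumFields.YangMills.Theorems.WeakCouplingRates

variable {H : ℕ}

/-- `Plaq.shift dirCorner` undoes the un-shifting `(x, i<j) ↦ (x − dirCorner, i, j)` of `ℤ⁴`-plaquettes to Chatterjee's labels of the
enlarged box. -/
theorem shift_unshift_dirCorner (p : ZdPlaquette 4) :
    Plaq.shift dirCorner ((p.1 - dirCorner, p.2.1.1, p.2.1.2) : Plaq 4) = (p.1, p.2.1.1, p.2.1.2) := by
  simp [Plaq.shift]

/-- The un-shifting map is injective. -/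
theorem unshift_dirCorner_injective :
    Function.Injective (fun p : ZdPlaquette 4 => ((p.1 - dirCorner, p.2.1.1, p.2.1.2) : Plaq 4)) := by
  intro p q h
  simp only [Prod.mk.injEq, sub_left_inj] at h
  obtain ⟨h1, h2, h3⟩ := h
  refine Prod.ext h1 (Subtype.ext (Prod.ext h2 h3))

/-- A plaquette touching the cold box `Λ = boxEdges 4 (2H+1)` has its base point in `[−1, 2H]⁴`. -/
theorem fst_bounds_of_touching {p : ZdPlaquette 4} (hp : p ∈ plaquettesTouching (boxEdges 4 (2 * H + 1))) (k : Fin 4) :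
    -1 ≤ p.1 k ∧ p.1 k ≤ 2 * (H : ℤ) := by
  rw [mem_plaquettesTouching_iff] at hp
  obtain ⟨e, he⟩ := hp
  rw [mem_inter] at he
  obtain ⟨he1, he2⟩ := he
  obtain ⟨y, l⟩ := e
  have hy := (mem_boxEdges_iff.1 he2).1 k
  simp only [plaquetteEdges, mem_insert, mem_singleton, Prod.mk.injEq] at he1
  have hs : ∀ (i : Fin 4), (p.1 + Pi.single i (1 : ℤ) : Site 4) k = p.1 k + (if k = i then 1 else 0) := fun i => by
    simp only [Pi.add_apply, Pi.single_apply]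
  rcases he1 with ⟨rfl, -⟩ | ⟨rfl, -⟩ | ⟨rfl, -⟩ | ⟨rfl, -⟩
  · constructor <;> omega
  · rw [hs] at hy; split_ifs at hy <;> constructor <;> omega
  · rw [hs] at hy; split_ifs at hy <;> constructor <;> omega
  · constructor <;> omega

/-- **Every plaquette touching the cold box lies in the enlarged box** `dirCorner + {0,…,2H+2}⁴`. -/
theorem unshift_mem_plaquettesIn {p : ZdPlaquette 4} (hp : p ∈ plaquettesTouching (boxEdges 4 (2 * H + 1))) :
    ((p.1 - dirCorner, p.2.1.1, p.2.1.2) : Plaq 4) ∈ plaquettesIn (halfOpenBox 4 (2 * H + 3)) := by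
  have hb := fst_bounds_of_touching hp
  rw [Plaq.mem_plaquettesIn]
  simp only [mem_halfOpenBox, Pi.sub_apply, Pi.add_apply, dirCorner, Pi.single_apply]
  refine ⟨fun k => ?_, p.2.2, fun k => ?_, fun k => ?_, fun k => ?_⟩
  · have := hb k; push_cast; omega
  · have := hb k; split_ifs <;> push_cast <;> omega
  · have := hb k; split_ifs <;> push_cast <;> omega
  · have := hb k
    have hne : (p.2.1.1 : Fin 4) ≠ p.2.1.2 := ne_of_lt p.2.2
    by_cases h1 : k = p.2.1.1 <;> by_cases h2 : k = p.2.1.2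
    · exact absurd (h1.symm.trans h2) hne
    · simp only [if_pos h1, if_neg h2]; push_cast; omega
    · simp only [if_neg h1, if_pos h2]; push_cast; omega
    · simp only [if_neg h1, if_neg h2]; push_cast; omega

/-- **The Dirichlet form is the sum over plaquettes touching the cold box**:
`M(s) = Σ_{p ∈ plaquettesTouching Λ} s(p)²` for the pinned problem of D1'. -/
theorem formM_dir_eq_sum_touching (s : DirFree H → ℝ) :
    formM (fun e => e ∉ dirFreeEdges H) dirCorner (2 * H + 3) 0 s =
      ∑ p ∈ plaquettesTouching (boxEdges 4 (2 * H + 1)), (sCirc (dirGlue H s) (p.1, p.2.1.1, p.2.1.2)) ^ 2 := by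
  classical
  rw [formM]
  change ∑ q ∈ plaquettesIn (halfOpenBox 4 (2 * H + 3)), sCirc (dirGlue H s) (Plaq.shift dirCorner q) ^ 2 = _
  have hR : ∑ p ∈ plaquettesTouching (boxEdges 4 (2 * H + 1)), (sCirc (dirGlue H s) (p.1, p.2.1.1, p.2.1.2)) ^ 2 =
      ∑ q ∈ (plaquettesTouching (boxEdges 4 (2 * H + 1))).image
        (fun p : ZdPlaquette 4 => ((p.1 - dirCorner, p.2.1.1, p.2.1.2) : Plaq 4)),
        sCirc (dirGlue H s) (Plaq.shift dirCorner q) ^ 2 := by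
    rw [sum_image (fun p _ q _ h => unshift_dirCorner_injective h)]
    refine sum_congr rfl fun p _ => ?_
    rw [shift_unshift_dirCorner]
  rw [hR]
  symm
  refine sum_subset ?_ ?_
  · intro q hq
    rw [mem_image] at hq
    obtain ⟨p, hp, rfl⟩ := hq
    exact unshift_mem_plaquettesIn hp
  · intro q hq hnot
    have hlt : q.2.1 < q.2.2 := (Plaq.mem_plaquettesIn.1 hq).2.1
    set p : ZdPlaquette 4 := (q.1 + dirCorner, ⟨(q.2.1, q.2.2), hlt⟩) with hpdef
    have hq' : ((p.1 - dirCorner, p.2.1.1, p.2.1.2) : Plaq 4) = q := by simp [hpdef]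
    have hp : p ∉ plaquettesTouching (boxEdges 4 (2 * H + 1)) := fun h => hnot (mem_image.2 ⟨p, h, hq'⟩)
    have h0 := sCirc_dirGlue_eq_zero_of_not_touching s hp
    have hshift : Plaq.shift dirCorner q = (p.1, p.2.1.1, p.2.1.2) := by rw [← hq', shift_unshift_dirCorner]
    rw [hshift, h0]; simp

/-- Corollary in the `EuclideanSpace` spelling of D1': the Gaussian weight of `boxDirichlet H` at `t` is
`exp(−½ Σ_{p touching Λ} (dirCirc H p t)²)`. -/
theorem gaussWeight_dir_eq_exp_sum_touching (t : EuclideanSpace ℝ (DirFree H)) :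
    GaussianToolkit.gaussWeight (Qmat (fun e => e ∉ dirFreeEdges H) dirCorner (2 * H + 3)) t =
      ENNReal.ofReal (Real.exp (-(∑ p ∈ plaquettesTouching (boxEdges 4 (2 * H + 1)),
        (dirCirc H (p.1, p.2.1.1, p.2.1.2) t) ^ 2) / 2)) := by
  rw [gaussWeight_dirQmat, formM_dir_eq_sum_touching]; rfl

end Summit.QuantumFields.YangMills.Theorems.WeakCouplingRates

end
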